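import Literature.Computability.QuantumComplexity.CWrapReadLaw
import Literature.Computability.QuantumComplexity.CWrapAssembly
import Literature.Computability.QuantumComplexity.PolyCopiesIdxLaw
import Literature.Computability.QuantumComplexity.PolyCopiesIdxUniform
import Literature.Computability.Cryptography.LWEHardness
import Literature.Probability.Distributions.IndepProductLawDistance
import HarnessLib

/-!
# Wrapper LAWS for uniform quantum families: randomised classical wraps and parallel indexed copies

Sixth module of the Part-3 first formalisation of Regev's worst-case-to-average-case reduction
(… → `RegevReductionCVPqBlockCoins` → this file); generic glue in `UniformQCircuitFamily` form
(the bundled uniform oracle-free families over which `LWEHardness.lean` / the named fact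
`regev2009_lemma_3_11_cvpqPlumbing` (A_plumb) quantify). HONEST FRAMING: the value of this file is a
THEOREM — exact LAW identities for the tree's wrapper constructions, packaged for a KNOWN reduction
(Regev 2009) — NOT progress on any summit; it breaks nothing; no named fact is introduced (debt 0).

## What is here

The tree proves, for the classical wrap `CWrap` (compute `h x`, run `F`, write `g ⟨x, y⟩` in front),
the coin prefix `CoinPrefix` (Hadamard coins appended to the input) and the parallel indexed copies
`PolyCopiesIdx` (copy `j` runs `F` on `x ++ e_j`), EXACT laws: `CWrap.map_kernel_eq_of_read`,
`CoinPrefix.kernel_eq_bind`, `PolyCopiesIdx.kernel_map_segments`. This file restates them as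
EXISTENCE OF UNIFORM FAMILIES with a law, the shape a consumer such as A_plumb needs:

* `exists_cwrap_law` — `h, g ∈ FP`, `F` uniform ⟹ `∃ T` uniform with
  `(T.kernel x).map read = (F.kernel (h x)).map R` for every reader `read` that returns `R y` on the
  strings with prefix `g ⟨x, y⟩`;
* `exists_coin_cwrap_law` — the randomised version: `(T.kernel x).map read =
  U({0,1}^{pc |x|}) >>= fun c => (F.kernel (h (x ++ c))).map (R c)`;
* `exists_polyCopies_params`, `polyCopiesIdx`, `polyCopiesIdx_kernel_map_read` — the indexed copies of
  a uniform family as a uniform family, and the law of the values read off its segments: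
  `⨂ⱼ (F.kernel (x ++ e_j)).map readB`;
* `exists_copies_post_law` — copies followed by a classical post-processing `g ∈ FP`:
  `(T.kernel x).map read = (⨂ⱼ (F.kernel (x ++ e_j)).map readB).map post`;
* `indepLaw_map_castLE`, `map_post_restrict_eq` — reading only the first `K' ≤ K(|x|)` blocks (the
  number of copies is a polynomial of the input LENGTH; a consumer needing fewer blocks reads a prefix).

How A_plumb is meant to use it (recorded, not done here): block family `T₁` from
`exists_coin_cwrap_law` with `h` = the manufacture of the shifted coarse samples of
`Regev2009.blockOfBits` (module 5) in `W`'s input encoding and `g` = the identity pairing; its law per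
copy is module 5's `uniformVector_bind_blockOfBits_withAnswer`; then `exists_polyCopies_params T₁ pK`,
and `exists_copies_post_law` with the post-processing that computes `firstAcceptedK` and prints the
digit table; `map_post_restrict_eq` trims the copies to the `(K_g+1)·J(n)` blocks needed.

Sources: Bernstein–Vazirani 1997, §8 and Thm. 8.3; Bennett–Bernstein–Brassard–Vazirani 1997,
Thm. 4.13–4.14 (proofs: independent parallel runs); Nielsen–Chuang 2010, §2.2.8, §4.4; Goldreich 2001,
§3.2.1 (a law is determined by its event probabilities); Regev 2009 (arXiv:2401.03703), §3.2.1.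
-/

noncomputable section

namespace Literature.Computability.Cryptography

namespace QWrap

open _root_.Computability Complexity QuantumComplexity Literature.Probability.Distributions
open scoped ENNReal

/-! ### Classical wrap: the law of a value read off the output -/

/-- **Classical pre- and post-processing around a uniform quantum family, LAW form.** For `h, g ∈ FP` and a
uniform oracle-free `F` there is a uniform oracle-free `T` such that, for every input `x` and every
total reader `read` that returns `R y` on every string with prefix `g ⟨x, y⟩` (`y` a possible output
of `F` on `h x`), the law of `read` under `T`'s kernel IS `(F.kernel (h x)).map R`.
[cite: BernsteinVazirani1997, §8 (classical computation inside quantum machines); Goldreich2001, §3.2.1] -/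
theorem exists_cwrap_law {h g : List Bool → List Bool} (hh : h ∈ FP) (hg : g ∈ FP)
    (F : UniformQCircuitFamily) :
    ∃ T : UniformQCircuitFamily, ∀ {β : Type} (x : List Bool) (read : List Bool → β) (R : List Bool → β),
      (∀ y ∈ (F.kernel (h x)).support, ∀ w : List Bool, g (boolPair x y) <+: w → read w = R y) →
        (T.kernel x).map read = (F.kernel (h x)).map R := by
  rcases F with ⟨Ff, hFfree, hFU⟩
  obtain ⟨P, hPh, hPg, hPF⟩ := CWrap.exists_params hh hg hFU
  subst hPh hPg hPF
  exact ⟨⟨CWrap.family P, CWrap.family_isOracleFree P hFfree, CWrap.family_isUniform P hFU⟩,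
    fun x read R hR => CWrap.map_kernel_eq_of_read P x read R hR⟩

/-! ### Randomised classical wrap: coins in front -/

/-- **Randomised classical pre- and post-processing around a uniform quantum family, LAW form.** For
`h, g ∈ FP`, a uniform oracle-free `F` and a coin polynomial `pc` there is a uniform oracle-free `T`
which on input `x` draws `c ∈ {0,1}^{pc(|x|)}` uniformly, runs `F` on `h (x ++ c)` and writes
`g ⟨x ++ c, y⟩` in front of its output — in the sense that for every reader `read` returning `R c y` on
every string with prefix `g ⟨x ++ c, y⟩`, the law of `read` under `T`'s kernel IS the uniform MIXTURE
`U(coins) >>= fun c => (F.kernel (h (x ++ c))).map (R c)`. [cite: BernsteinVazirani1997, Thm. 8.3 (proof: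
Hadamard coins) and §8; NielsenChuang2010, §4.4; Goldreich2001, §3.2.1] -/
theorem exists_coin_cwrap_law {h g : List Bool → List Bool} (hh : h ∈ FP) (hg : g ∈ FP)
    (F : UniformQCircuitFamily) (pc : Polynomial ℕ) :
    ∃ T : UniformQCircuitFamily, ∀ {β : Type} (x : List Bool) (read : List Bool → β)
      (R : QReg (pc.eval x.length) → List Bool → β),
      (∀ c : QReg (pc.eval x.length), ∀ y ∈ (F.kernel (h (x ++ List.ofFn c))).support, ∀ w : List Bool,
          g (boolPair (x ++ List.ofFn c) y) <+: w → read w = R c y) →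
        (T.kernel x).map read =
          (PMF.uniformOfFintype (QReg (pc.eval x.length))).bind fun c =>
            (F.kernel (h (x ++ List.ofFn c))).map (R c) := by
  rcases F with ⟨Ff, hFfree, hFU⟩
  obtain ⟨P₀, hPh, hPg, hPF⟩ := CWrap.exists_params hh hg hFU
  subst hPh hPg hPF
  let P : CoinPrefix.Params := ⟨CWrap.family P₀, pc⟩
  refine ⟨⟨CoinPrefix.family P, CoinPrefix.family_isOracleFree P (CWrap.family_isOracleFree P₀ hFfree),
    CoinPrefix.family_isUniform P (CWrap.family_isUniform P₀ hFU)⟩, fun x read R hR => ?_⟩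
  show ((CoinPrefix.family P).kernel 0 x).map read = _
  rw [CoinPrefix.kernel_eq_bind P (CWrap.inputRecoverable P₀) x, PMF.map_bind]
  refine congrArg ((PMF.uniformOfFintype (QReg (pc.eval x.length))).bind ·) (funext fun c => ?_)
  exact CWrap.map_kernel_eq_of_read P₀ (x ++ List.ofFn c) read (R c) (hR c)

/-! ### Parallel indexed copies: the law of what is read off the segments -/

/-- **The layout of `pK(|x|) + 1` parallel indexed copies of a uniform family exists** (the ancilla
polynomial from uniformity). [cite: BennettBernsteinBrassardVazirani1997, Thm. 4.13–4.14 (proofs)] -/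
theorem exists_polyCopies_params (F : UniformQCircuitFamily) (pK : Polynomial ℕ) :
    ∃ P : PolyCopies.Params, P.F = F.family ∧ P.pK = pK := by
  obtain ⟨pF, hpF⟩ := QCircuitFamily.IsUniform.isPolySize_holds F.isUniform
  exact ⟨⟨F.family, pF, fun m => (hpF m).2, pK⟩, rfl, rfl⟩

/-- The indexed-copies family of a uniform family, as a uniform family. [cite: BennettBernsteinBrassardVazirani1997, Thm. 4.13 (proof)] -/
def polyCopiesIdx (P : PolyCopies.Params) (hfree : P.F.IsOracleFree) (hU : P.F.IsUniform) :
    UniformQCircuitFamily :=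
  ⟨PolyCopiesIdx.family P, PolyCopiesIdx.family_isOracleFree P hfree, PolyCopiesIdx.family_isUniform P hU⟩

/-- **The law of the values read off the segments of the indexed-copies family IS the independent
product of the values read off the copies**: copy `j` runs `F` on `x ++ e_j`.
[cite: NielsenChuang2010, §2.2.8 (measurement statistics of a product state); BennettBernsteinBrassardVazirani1997, Thm. 4.14 (proof)] -/
theorem polyCopiesIdx_kernel_map_read {β : Type} (P : PolyCopies.Params) (hfree : P.F.IsOracleFree)
    (hU : P.F.IsUniform) (x : List Bool) (readB : List Bool → β) :
    ((polyCopiesIdx P hfree hU).kernel x).map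
        (fun w => fun j : Fin (PolyCopiesIdx.K P x.length) => readB (PolyCopiesIdx.segment P x.length w j)) =
      indepLaw (PolyCopiesIdx.K P x.length) fun j => (P.F.kernel 0 (PolyCopiesIdx.inputIdx P x j)).map readB := by
  have hfun : (fun w : List Bool => fun j : Fin (PolyCopiesIdx.K P x.length) =>
      readB (PolyCopiesIdx.segment P x.length w j)) =
      (fun v : Fin (PolyCopiesIdx.K P x.length) → List Bool => fun j => readB (v j)) ∘
        fun w => fun j : Fin (PolyCopiesIdx.K P x.length) => PolyCopiesIdx.segment P x.length w j := rfl
  show ((PolyCopiesIdx.family P).kernel 0 x).map _ = _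
  rw [hfun, ← PMF.map_comp, PolyCopiesIdx.kernel_map_segments]
  exact (indepLaw_map_pi _ _ fun _ => readB).trans
    (congrArg (indepLaw _) (funext fun j => by rw [PolyCopiesIdx.blockLaw_eq_kernel]))

/-! ### Copies of a block family, then a classical post-processing: the assembled law -/

/-- **Parallel copies + classical post-processing, LAW form.** Given the layout `P` of the indexed
copies of a uniform oracle-free block family and `g ∈ FP`, there is a uniform oracle-free `T` which on
input `x` runs the `K(|x|)` copies (copy `j` on `x ++ e_j`) and writes `g ⟨x, y⟩` in front, `y` the
measured register of the copies family: for every block reader `readB`, every `post` and every total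
reader `read` with `read w = post (fun j => readB (segment y j))` whenever `g ⟨x, y⟩ <+: w`, the law of
`read` under `T`'s kernel IS `(⨂ⱼ (F.kernel (x ++ e_j)).map readB).map post`.
[cite: BennettBernsteinBrassardVazirani1997, Thm. 4.14 (proof: non-adaptive queries in parallel);
BernsteinVazirani1997, §8; NielsenChuang2010, §2.2.8] -/
theorem exists_copies_post_law (P : PolyCopies.Params) (hfree : P.F.IsOracleFree) (hU : P.F.IsUniform)
    {g : List Bool → List Bool} (hg : g ∈ FP) :
    ∃ T : UniformQCircuitFamily, ∀ {β γ : Type} (x : List Bool) (readB : List Bool → β)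
      (post : (Fin (PolyCopiesIdx.K P x.length) → β) → γ) (read : List Bool → γ),
      (∀ y ∈ ((polyCopiesIdx P hfree hU).kernel x).support, ∀ w : List Bool, g (boolPair x y) <+: w →
          read w = post fun j => readB (PolyCopiesIdx.segment P x.length y j)) →
        (T.kernel x).map read =
          (indepLaw (PolyCopiesIdx.K P x.length) fun j =>
              (P.F.kernel 0 (PolyCopiesIdx.inputIdx P x j)).map readB).map post := by
  obtain ⟨T, hT⟩ := exists_cwrap_law (h := fun w : List Bool => w) (PolyTimeComputable.id _) hg (polyCopiesIdx P hfree hU)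
  refine ⟨T, fun x readB post read hR => ?_⟩
  rw [hT x read (fun y => post fun j => readB (PolyCopiesIdx.segment P x.length y j)) hR,
    ← polyCopiesIdx_kernel_map_read P hfree hU x readB, PMF.map_comp]
  rfl

/-! ### Reading only the first copies: the prefix marginal along `Fin.castLE` -/

/-- **Prefix marginal of an independent product along `Fin.castLE`** (the number of copies of a
parallel family is a polynomial of the input LENGTH; a consumer that needs `K' ≤ K(|x|)` blocks reads
the first `K'` segments, which are independent with the same block laws). [folklore] -/
theorem indepLaw_map_castLE {α : Type} {K K' : ℕ} (hK : K' ≤ K) (D : Fin K → PMF α) :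
    (indepLaw K D).map (fun v => fun j : Fin K' => v (Fin.castLE hK j)) =
      indepLaw K' fun j => D (Fin.castLE hK j) := by
  obtain ⟨r, rfl⟩ := Nat.exists_eq_add_of_le hK
  have hc : (fun j : Fin K' => Fin.castLE hK j) = fun j => Fin.castAdd r j := funext fun j => Fin.ext rfl
  have h1 : (fun v : Fin (K' + r) → α => fun j : Fin K' => v (Fin.castLE hK j)) =
      fun v => fun j : Fin K' => v (Fin.castAdd r j) := by
    funext v; funext j; rw [show Fin.castLE hK j = Fin.castAdd r j from congrFun hc j]
  have h2 : (fun j : Fin K' => D (Fin.castLE hK j)) = fun j => D (Fin.castAdd r j) := by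
    funext j; rw [show Fin.castLE hK j = Fin.castAdd r j from congrFun hc j]
  rw [h1, h2]
  exact LWE.indepLaw_map_castAdd D

/-- **Copies + post-processing that reads only the first `K'` blocks.** In the situation of
`exists_copies_post_law`, if the reader's value depends only on the first `K' ≤ K(|x|)` segments
(`post = post' ∘ restrict`), its law is `(⨂_{j<K'} (F.kernel (x ++ e_j)).map readB).map post'`.
[cite: BennettBernsteinBrassardVazirani1997, Thm. 4.14 (proof); NielsenChuang2010, §2.2.8] -/
theorem map_post_restrict_eq {β γ : Type} (P : PolyCopies.Params) (x : List Bool) (readB : List Bool → β)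
    {K' : ℕ} (hK : K' ≤ PolyCopiesIdx.K P x.length) (post' : (Fin K' → β) → γ) :
    (indepLaw (PolyCopiesIdx.K P x.length) fun j =>
        (P.F.kernel 0 (PolyCopiesIdx.inputIdx P x j)).map readB).map
        (fun v => post' fun j : Fin K' => v (Fin.castLE hK j)) =
      (indepLaw K' fun j : Fin K' =>
        (P.F.kernel 0 (PolyCopiesIdx.inputIdx P x (Fin.castLE hK j))).map readB).map post' := by
  have h := indepLaw_map_castLE hK fun j : Fin (PolyCopiesIdx.K P x.length) =>
    (P.F.kernel 0 (PolyCopiesIdx.inputIdx P x j)).map readB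
  rw [← h, PMF.map_comp]
  rfl

end QWrap

end Literature.Computability.Cryptography

end
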